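import Literature.Analysis.FluidPDE.NSLocalLerayFarFieldVorticityBypass
import Literature.Analysis.FluidPDE.NSLocalLerayBackwardUniquenessUC
import Literature.Analysis.FluidPDE.GKPRigidityProofs
import Literature.Analysis.FluidPDE.NSBoundedMildOseenClassical
import HarnessLib

/-!
# GKP Proposition 2.3, Step D: backward uniqueness and unique continuation for the vorticity
# (the far-field backward-uniqueness step in a general frame, and the rigidity endgame for
# classical solutions vanishing weakly at the final time)

Analysis/FluidPDE proof file (theorems only: no definition, no named fact, no `sorry`) in the
cone of `Literature.Analysis.FluidPDE.hasSmoothExtensionPast_of_eHomBesovNorm_bounded`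
(`NSCriticalClosure.lean`; Gallagher–Koch–Planchon 2016, Thm. 1) along **GKP's own proof line**
(§2.1: Thm. 1 ⇐ Props. 2.1, 2.2, 2.3). It continues `GKPRigidityProofs.lean`, which proves
Steps C and E of the printed proof of **Prop. 2.3** (rigidity of critical elements, §2.5,
arXiv:1407.4156 p. 9) and its endgame, by supplying **Step D**:

> "backwards uniqueness and unique continuation (note that in applying the latter we need the
> smoothness inside `K` at earlier times provided by (1.6)) applied to the vorticity
> `ω := ∇ × u` as in [ESS] allow us to conclude that in fact `u(·, t) ≡ 0` for some
> `t ∈ (0, T*)`" (GKP 2016, §2.5, p. 9; the argument referred to is Escauriaza–Seregin–Šverák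
> 2003, §5, proof of Thm. 1.3, and Kenig–Koch 2011, §3).

What is proved, bottom-up:

* `farField_curl_eq_zero_of_frame` — **the far-field backward-uniqueness step in a general
  frame** (ESS 2003, §3 (3.31)–(3.32) with Thm. 5.1; GKP §2.5 Step D, first half). Let `ν > 0`,
  `T₄ < T₁`, `R ≥ 0`, and let `(U, p)` solve the Navier–Stokes system in the sense of
  distributions on the far-field region `Ω = (T₄, T₁) × {|x| > R}`, with `C^∞` slices at the
  points of `Ω`, jointly continuous spatial derivatives `D_xⁿU` (`n ≤ 4`) and `‖D_xⁿU‖ ≤ K`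
  (`n ≤ 3`) on `Ω`; let `u = U` a.e. on `Ω` be a field whose slices tend to zero weakly as
  `t ↑ T₁` (`∫ ⟪u(t), φ⟫ → 0` for every smooth compactly supported `φ`). Then
  `∇ ∧ U(t, ·) = 0` on `{|x| > R + √(ν (T₁ - T₄))}` for every `t ∈ (T₄, T₁)`. This is the
  accepted normal-form theorem `farField_curl_eq_zero` (`ESSLocalHolderNoConcentration.lean`:
  viscosity `1`, window `]-1, 0[`) transported by the Navier–Stokes rescaling
  `Φ(s, y) = (T₁ + βs, γy)`, `β = T₁ - T₄`, `γ = √(νβ)`, exactly as in the accepted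
  `localLeray_farField_vorticity_eq_zero_slab_of_higherRegularityBounds`
  (`NSLocalLerayFarFieldVorticityBypass.lean`), whose Step 3 it isolates from the local Leray /
  `L³` setting of Lemarié-Rieusset's Thm. 15.4: the statement here is about an arbitrary pair on
  a far-field region and is the form in which the step is used for `NS(u₀)` in GKP §2.5, for
  Albritton's limit solution (arXiv:1612.04439, §3, Step 3) and for Wang–Zhang's blow-up limit
  (arXiv:1510.02589, §4, Step 3).
* `tendsto_integral_inner_of_tendsto_temperedDistribution_zero` — the hypothesis
  "`NS(u₀)(t) → 0` in `𝓢'`" of Prop. 2.3, carried by the distributions `U t` of the slices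
  (`IsDistributionOf`), gives the weak vanishing of the slices against real vector test fields
  used above (coordinatewise, through the complexification).
* `IsClassicalNSSolutionOn.curl_eq_zero_of_farField_of_tendsto` — **Step D for a classical
  solution** (GKP §2.5 with (1.6): "`u ∈ C^∞(ℝ³ × (0, T*))`"): if `(u, π)` is a classical
  solution on the open strip `(0, T)`, `ν > 0`, with `‖D_xⁿu‖ ≤ K` (`n ≤ 3`) on a far-field
  region `(T₄, T) × {|x| > R}`, `0 < T₄ < T`, and `u(t) → 0` weakly as `t ↑ T`, then
  `∇ ∧ u(t, ·) ≡ 0` on `ℝ³` for every `t ∈ (T₄, T)`: the far field by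
  `farField_curl_eq_zero_of_frame`, the interior by the unique continuation of the vorticity of
  a classical solution through spatial boundaries (`IsClassicalNSSolutionOn.curl_eq_zero_of_eqOn_ball`,
  ESS Thm. 4.1 — "we need the smoothness inside `K` at earlier times").
* `IsClassicalNSSolutionOn.eq_zero_of_farField_of_tendsto` — **Steps D–E**: if moreover the
  slices `u t`, `t ∈ (T₄, T)`, are bounded and their tempered distributions lie in some
  homogeneous Besov space `Ḃ^s_{p,q}` (realisation), then `u(t, ·) ≡ 0` for every
  `t ∈ (T₄, T)` (Step E of `GKPRigidityProofs.lean`: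
  `eq_zero_of_curl_eq_zero_of_isDivFree_of_memHomBesov`, KNSS 2009 Lemma 3.1).
* `IsBesovMildSolutionOn.eq_zero_of_classical_of_farField_of_tendsto` — the same for a Besov
  mild solution `(u, U)` on `[0, T)` of the tree's class which is classical on `(0, T)` (the
  printed (1.6) for `NS(u₀)`), with the printed hypothesis `U t → 0` in `𝓢'(ℝ³, ℂ³)` as
  `t → T⁻` and the far-field derivative bounds near `T`: `u(t, ·) ≡ 0` for all `t ∈ (T₄, T)`
  (boundedness of the slices from Kato's class, Besov membership from
  `ContinuousInHomBesovOn`).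

What is **not** proved here (and is not restated): Prop. 2.8 (positive regularity at blow-up,
§§4–5) and the ε-regularity step "`(u, π)` forms a suitable weak solution and is smooth at and
near the time `T*` outside of some large compact set" which together *produce* the far-field
derivative bounds taken here as the hypothesis `hbd`; and the last sentence "therefore
`T* = ∞` by small data results" beyond the form already in `GKPRigidityProofs.lean`.

## Mathlib / tree search

Tree: `farField_curl_eq_zero`, `IsDistributionalNSSolutionOn.stRescale`, `stPull`, `stAffine`,
`ae_eq_restrict_comp_stAffine` (`ESSLocalHolderNoConcentration.lean` and its imports);
`preimage_rescale_farField`, `iteratedFDeriv_slice_comp_continuousLinearEquiv`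
(`NSLocalLerayFarFieldVorticityBypass.lean`); `IsClassicalNSSolutionOn.curl_eq_zero_of_eqOn_ball`
(`NSLocalLerayBackwardUniquenessUC.lean`); `isDistributionalNSSolutionOn_of_contDiffOn`
(`ClassicalSuitable.lean`); `IsSmoothSpaceTimeOn.iteratedFDeriv_slice`
(`TaoEnstrophyLocalisation.lean`), `IsSmoothSpaceTimeOn.contDiffAt` (`SpaceTimeCalculus.lean`);
`eq_zero_of_curl_eq_zero_of_isDivFree_of_memHomBesov` (`GKPRigidityProofs.lean`);
`norm_le_of_eLpNorm_top_le_of_continuous` (`NSBoundedMildOseenClassical.lean`);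
`IsDistributionOf.locallyIntegrable` (`BesovMildBounds.lean`). Mathlib:
`PointwiseConvergenceCLM.tendsto_iff_forall_tendsto`, `HasCompactSupport.toSchwartzMap`,
`ContinuousLinearMap.integral_comp_comm`, `tendsto_pi_nhds`, `Measure.integral_comp_smul`.

## References

* I. Gallagher, G. S. Koch, F. Planchon, *Blow-up of critical Besov norms at a potential
  Navier–Stokes singularity*, Comm. Math. Phys. 343 (2016) 39–82 = arXiv:1407.4156: Prop. 2.3
  (§2.1, p. 6) and its proof, §2.5 (p. 9); (1.6). [GKP2016]
* L. Escauriaza, G. Seregin, V. Šverák, *`L_{3,∞}`-solutions of Navier–Stokes equations and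
  backward uniqueness*, Russ. Math. Surveys 58:2 (2003) 211–250: §3 (3.31)–(3.32), Thm. 4.1,
  Thm. 5.1, §5 (proof of Thm. 1.3). [EscauriazaSereginSverak2003]
* C. E. Kenig, G. S. Koch, *An alternative approach to regularity for the Navier–Stokes
  equations in critical spaces*, Ann. IHP (C) 28 (2011) 159–187, §3 (the rigidity argument GKP
  refer to). [KenigKoch2011]
* G. Koch, N. Nadirashvili, G. Seregin, V. Šverák, Acta Math. 203 (2009) 83–105, Lemma 3.1.
  [KochNadirashviliSereginSverak2009]
-/

noncomputable section

open MeasureTheory TopologicalSpace Set Function Filter Metric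
open _root_.Topology
open scoped ENNReal NNReal InnerProductSpace RealInnerProductSpace SchwartzMap

namespace Literature.Analysis.FluidPDE

/-! ### The far-field backward-uniqueness step in a general frame -/

set_option maxHeartbeats 800000 in
/-- **The far-field vorticity vanishes, general frame** (Escauriaza–Seregin–Šverák 2003, §3,
(3.31)–(3.32) with the half-space backward uniqueness Thm. 5.1; the first half of Step D of the
proof of GKP 2016, Prop. 2.3, §2.5 p. 9: "backwards uniqueness … applied to the vorticity
`ω := ∇ × u` as in [ESS]"). Let `ν > 0`, `T₄ < T₁`, `R ≥ 0`, and on the far-field region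
`Ω = (T₄, T₁) × {|x| > R}` let `(U, p)` solve the Navier–Stokes system (viscosity `ν`, no force)
in the sense of distributions, with `C^∞` slices at the points of `Ω`, jointly continuous
spatial derivatives `(t, x) ↦ D_xⁿU(t, x)` for `n ≤ 4`, and `‖D_xⁿU‖ ≤ K` on `Ω` for `n ≤ 3`;
let `u` agree with `U` a.e. on `Ω` and have slices tending to zero weakly as `t ↑ T₁`:
`∫ ⟪u(t), φ⟫ → 0` for every smooth compactly supported `φ`. Then `∇ ∧ U(t, ·) = 0` at every
point of `{|x| > R + √(ν (T₁ - T₄))}`, for every `t ∈ (T₄, T₁)`. Proof: the Navier–Stokes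
rescaling `Φ(s, y) = (T₁ + βs, γy)`, `β = T₁ - T₄`, `γ = √(νβ)`, `α = γ/ν`, takes the
normalised region `]-1, 0[ × {|y| > R/γ}` onto `Ω`; `(αU∘Φ, α²p∘Φ)` solves the unit-viscosity
equations there (`IsDistributionalNSSolutionOn.stRescale`) with the same kind of bounds, equals
`αu∘Φ` a.e., and `∫ ⟪αu(T₁ + βs, γy), φ(y)⟫ dy = α γ⁻³ ∫ ⟪u(T₁ + βs), φ(·/γ)⟫ → 0` as
`s ↑ 0`; the normal-form theorem `farField_curl_eq_zero` gives `∇ ∧ (αU∘Φ) = 0` on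
`]-1, 0[ × {|y| > R/γ + 1}`, i.e. `∇ ∧ U(t, ·) = 0` on `{|x| > R + γ}`
(`∇ ∧ (αU(t, γ·))(y) = αγ ∇ ∧ U(t, γy)`). This is Step 3 of the accepted
`localLeray_farField_vorticity_eq_zero_slab_of_higherRegularityBounds`, isolated from the
local Leray setting. [cite: EscauriazaSereginSverak2003, §3 (3.31)-(3.32) and Thm. 5.1] [cite: GKP2016, §2.5 (proof of Prop. 2.3)] -/
theorem farField_curl_eq_zero_of_frame {ν T₄ T₁ R K : ℝ} (hν : 0 < ν) (hT₄ : T₄ < T₁)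
    (hR : 0 ≤ R) {u U : ℝ → EuclideanSpace ℝ (Fin 3) → EuclideanSpace ℝ (Fin 3)}
    {p : ℝ → EuclideanSpace ℝ (Fin 3) → ℝ}
    (hfinal : ∀ φ : EuclideanSpace ℝ (Fin 3) → EuclideanSpace ℝ (Fin 3),
      FunctionSpaces.IsTestFunctionOn (⊤ : Opens (EuclideanSpace ℝ (Fin 3))) φ →
        Tendsto (fun t => ∫ x, ⟪u t x, φ x⟫) (𝓝[<] T₁) (𝓝 0))
    (hae : uncurry U =ᵐ[volume.restrict
      (Ioo T₄ T₁ ×ˢ (closedBall (0 : EuclideanSpace ℝ (Fin 3)) R)ᶜ)] uncurry u)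
    (hsolU : IsDistributionalNSSolutionOn
      ⟨Ioo T₄ T₁ ×ˢ (closedBall (0 : EuclideanSpace ℝ (Fin 3)) R)ᶜ,
        isOpen_Ioo.prod isClosed_closedBall.isOpen_compl⟩ ν 0 U p)
    (hCD : ∀ w ∈ Ioo T₄ T₁ ×ˢ (closedBall (0 : EuclideanSpace ℝ (Fin 3)) R)ᶜ,
      ContDiffAt ℝ (⊤ : ℕ∞) (U w.1) w.2)
    (hjc : ∀ n ≤ 4, ContinuousOn
      (fun w : ℝ × EuclideanSpace ℝ (Fin 3) => iteratedFDeriv ℝ n (U w.1) w.2)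
      (Ioo T₄ T₁ ×ˢ (closedBall (0 : EuclideanSpace ℝ (Fin 3)) R)ᶜ))
    (hbdK : ∀ n ≤ 3, ∀ w ∈ Ioo T₄ T₁ ×ˢ (closedBall (0 : EuclideanSpace ℝ (Fin 3)) R)ᶜ,
      ‖iteratedFDeriv ℝ n (U w.1) w.2‖ ≤ K) :
    ∀ t ∈ Ioo T₄ T₁, ∀ x : EuclideanSpace ℝ (Fin 3), R + Real.sqrt (ν * (T₁ - T₄)) < ‖x‖ →
      curl (U t) x = 0 := by
  set S : Set (EuclideanSpace ℝ (Fin 3)) := (closedBall (0 : EuclideanSpace ℝ (Fin 3)) R)ᶜ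
    with hSdef
  have hSo : IsOpen S := isClosed_closedBall.isOpen_compl
  set Ω : Set (ℝ × EuclideanSpace ℝ (Fin 3)) := Ioo T₄ T₁ ×ˢ S with hΩdef
  have hΩo : IsOpen Ω := isOpen_Ioo.prod hSo
  -- a nonnegative bound
  set K₀ : ℝ := max K 0 with hK₀def
  have hK₀ : 0 ≤ K₀ := le_max_right _ _
  have hbdK' : ∀ n ≤ 3, ∀ w ∈ Ω, ‖iteratedFDeriv ℝ n (U w.1) w.2‖ ≤ K₀ := fun n hn w hw =>
    (hbdK n hn w hw).trans (le_max_left _ _)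
  -- smoothness of the slices on `S`
  have hUS : ∀ t ∈ Ioo T₄ T₁, ContDiffOn ℝ 4 (U t) S := fun t ht x hx =>
    ((hCD (t, x) ⟨ht, hx⟩).of_le (by norm_cast)).contDiffWithinAt
  -- ### the Navier–Stokes rescaling to unit viscosity and the window `]-1, 0[`
  set β : ℝ := T₁ - T₄ with hβdef
  have hβ : 0 < β := sub_pos.2 hT₄
  set γ : ℝ := Real.sqrt (ν * β) with hγdef
  have hγ : 0 < γ := Real.sqrt_pos.2 (mul_pos hν hβ)
  have hγ0 : γ ≠ 0 := hγ.ne'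
  have hγ2 : γ ^ 2 = ν * β := Real.sq_sqrt (mul_pos hν hβ).le
  set α : ℝ := γ / ν with hαdef
  have hα : 0 < α := div_pos hγ hν
  have hαγ : β = α * γ := by
    rw [hαdef, div_mul_eq_mul_div, ← sq, hγ2]
    field_simp
  have hvisc : α * ν / γ = 1 := by
    rw [hαdef]
    field_simp
  have hαγ0 : α * γ ≠ 0 := mul_ne_zero hα.ne' hγ0
  -- the map `Φ`
  set Φ : ℝ × EuclideanSpace ℝ (Fin 3) → ℝ × EuclideanSpace ℝ (Fin 3) :=
    fun z => (T₁ + β * z.1, γ • z.2) with hΦdef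
  have hΦst : stAffine β γ T₁ (0 : EuclideanSpace ℝ (Fin 3)) = Φ := by
    funext z
    simp [stAffine, hΦdef]
  have hΦc : Continuous Φ := by
    rw [hΦdef]
    fun_prop
  -- the rescaled region
  set R' : ℝ := R / γ with hR'def
  have hR' : 0 ≤ R' := div_nonneg hR hγ.le
  set S' : Set (EuclideanSpace ℝ (Fin 3)) := (closedBall (0 : EuclideanSpace ℝ (Fin 3)) R')ᶜ
    with hS'def
  have hS'o : IsOpen S' := isClosed_closedBall.isOpen_compl
  set Ω' : Set (ℝ × EuclideanSpace ℝ (Fin 3)) := Ioo (-1 : ℝ) 0 ×ˢ S' with hΩ'def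
  have hΩ'o : IsOpen Ω' := isOpen_Ioo.prod hS'o
  have hpre : Φ ⁻¹' Ω = Ω' := by
    rw [hΦdef, hΩdef, hSdef, hΩ'def, hS'def, hR'def, hβdef]
    exact preimage_rescale_farField hT₄ hγ
  have hmaps : MapsTo Φ Ω' Ω := fun z hz => by
    have : z ∈ Φ ⁻¹' Ω := by rw [hpre]; exact hz
    exact this
  have hmaps1 : ∀ z ∈ Ω', T₁ + β * z.1 ∈ Ioo T₄ T₁ := fun z hz => (hmaps hz).1
  have hmaps2 : ∀ z ∈ Ω', γ • z.2 ∈ S := fun z hz => (hmaps hz).2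
  have hmapsγ : MapsTo (fun y : EuclideanSpace ℝ (Fin 3) => γ • y) S' S := by
    intro y hy
    rw [hS'def, mem_compl_iff, mem_closedBall, dist_zero_right, not_le, hR'def,
      div_lt_iff₀ hγ] at hy
    rw [hSdef, mem_compl_iff, mem_closedBall, dist_zero_right, not_le, norm_smul,
      Real.norm_of_nonneg hγ.le]
    linarith [mul_comm ‖y‖ γ]
  -- the rescaled fields
  obtain ⟨U', hU'def⟩ : ∃ U' : ℝ → EuclideanSpace ℝ (Fin 3) → EuclideanSpace ℝ (Fin 3),
      U' = α • stPull β γ T₁ (0 : EuclideanSpace ℝ (Fin 3)) U := ⟨_, rfl⟩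
  obtain ⟨w, hwdef⟩ : ∃ w : ℝ → EuclideanSpace ℝ (Fin 3) → EuclideanSpace ℝ (Fin 3),
      w = α • stPull β γ T₁ (0 : EuclideanSpace ℝ (Fin 3)) u := ⟨_, rfl⟩
  obtain ⟨π', hπ'def⟩ : ∃ π' : ℝ → EuclideanSpace ℝ (Fin 3) → ℝ,
      π' = α ^ 2 • stPull β γ T₁ (0 : EuclideanSpace ℝ (Fin 3)) p := ⟨_, rfl⟩
  have hU'app : ∀ s y, U' s y = α • U (T₁ + β * s) (γ • y) := fun s y => by
    rw [hU'def]
    simp [smul_stPull_apply]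
  have hwapp : ∀ s y, w s y = α • u (T₁ + β * s) (γ • y) := fun s y => by
    rw [hwdef]
    simp [smul_stPull_apply]
  -- the linear change of variables `e y = γ y`
  set e : EuclideanSpace ℝ (Fin 3) ≃L[ℝ] EuclideanSpace ℝ (Fin 3) :=
    ContinuousLinearEquiv.equivOfInverse
      (γ • ContinuousLinearMap.id ℝ (EuclideanSpace ℝ (Fin 3)))
      (γ⁻¹ • ContinuousLinearMap.id ℝ (EuclideanSpace ℝ (Fin 3)))
      (fun y => by simp [smul_smul, hγ0]) (fun y => by simp [smul_smul, hγ0]) with hedef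
  have he : ∀ y, e y = γ • y := fun y => rfl
  have henorm : ‖(e : EuclideanSpace ℝ (Fin 3) →L[ℝ] EuclideanSpace ℝ (Fin 3))‖ ≤ γ := by
    refine ContinuousLinearMap.opNorm_le_bound _ hγ.le fun y => ?_
    rw [ContinuousLinearEquiv.coe_coe, he y, norm_smul, Real.norm_of_nonneg hγ.le]
  have hU'fun : ∀ s, U' s = α • (U (T₁ + β * s) ∘ ⇑e) := fun s => by
    funext y
    rw [hU'app]
    rfl
  -- the formula for `D_yⁿ U'(s, ·)` at the points of `Ω'`
  have hformula : ∀ n : ℕ, ∀ z ∈ Ω', iteratedFDeriv ℝ n (U' z.1) z.2 =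
      α • (iteratedFDeriv ℝ n (U (T₁ + β * z.1)) (γ • z.2)).compContinuousLinearMap
        fun _ => (e : EuclideanSpace ℝ (Fin 3) →L[ℝ] EuclideanSpace ℝ (Fin 3)) := by
    intro n z hz
    have hca : ContDiffAt ℝ n (U (T₁ + β * z.1) ∘ ⇑e) z.2 := by
      refine ContDiffAt.comp z.2 ?_ e.contDiff.contDiffAt
      rw [he]
      exact (hCD (T₁ + β * z.1, γ • z.2) ⟨hmaps1 z hz, hmaps2 z hz⟩).of_le
        (by exact_mod_cast le_top)
    rw [hU'fun, iteratedFDeriv_const_smul_apply hca, iteratedFDeriv_slice_comp_continuousLinearEquiv,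
      he]
  -- ### (i) the rescaled pair solves the unit-viscosity equations in `𝒟'(Ω')`
  have hsol' : IsDistributionalNSSolutionOn ⟨Ω', hΩ'o⟩ 1 0 U' π' := by
    have h := hsolU.stRescale hα hγ hαγ T₁ (0 : EuclideanSpace ℝ (Fin 3))
    have e1 : stPreimage β γ T₁ (0 : EuclideanSpace ℝ (Fin 3)) ⟨Ω, hΩo⟩ =
        (⟨Ω', hΩ'o⟩ : Opens (ℝ × EuclideanSpace ℝ (Fin 3))) := by
      refine TopologicalSpace.Opens.ext ?_
      show stAffine β γ T₁ (0 : EuclideanSpace ℝ (Fin 3)) ⁻¹' Ω = Ω'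
      rw [hΦst, hpre]
    have e3 : (α ^ 2 * γ) • stPull β γ T₁ (0 : EuclideanSpace ℝ (Fin 3))
        (0 : ℝ → EuclideanSpace ℝ (Fin 3) → EuclideanSpace ℝ (Fin 3)) = 0 := by
      funext s y
      simp [stPull_apply]
    rw [e1, hvisc, e3, ← hU'def, ← hπ'def] at h
    exact h
  -- ### (ii) `U' = w` a.e. on `Ω'`
  have hae' : uncurry U' =ᵐ[volume.restrict Ω'] uncurry w := by
    have h0 := ae_eq_restrict_comp_stAffine hβ hγ T₁ (0 : EuclideanSpace ℝ (Fin 3)) hae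
    rw [hΦst, hpre] at h0
    filter_upwards [h0] with z hz
    have hz' : U (T₁ + β * z.1) (γ • z.2) = u (T₁ + β * z.1) (γ • z.2) := hz
    show U' z.1 z.2 = w z.1 z.2
    rw [hU'app, hwapp, hz']
  -- ### (iii) the slices of `w` tend weakly to zero at the top time `s = 0`
  have htop : ∀ φ : EuclideanSpace ℝ (Fin 3) → EuclideanSpace ℝ (Fin 3),
      ContDiff ℝ (⊤ : ℕ∞) φ → HasCompactSupport φ → ∀ ε : ℝ, 0 < ε →
      ∃ s₀ : ℝ, s₀ < 0 ∧ ∀ᵐ s ∂(volume.restrict (Ioo s₀ 0)), |∫ y, ⟪w s y, φ y⟫| ≤ ε := by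
    intro φ hφ hφc ε hε
    -- the dilated test field `ψ = φ(·/γ)`
    set ψ : EuclideanSpace ℝ (Fin 3) → EuclideanSpace ℝ (Fin 3) := fun x => φ (γ⁻¹ • x)
      with hψdef
    have hψ : FunctionSpaces.IsTestFunctionOn (⊤ : Opens (EuclideanSpace ℝ (Fin 3))) ψ :=
      { contDiff := hφ.comp (contDiff_const_smul _)
        hasCompactSupport :=
          hφc.comp_homeomorph (Homeomorph.smulOfNeZero γ⁻¹ (inv_ne_zero hγ0))
        tsupport_subset := fun y _ => Opens.mem_top y }
    have hψγ : ∀ y, ψ (γ • y) = φ y := fun y => by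
      simp only [hψdef, inv_smul_smul₀ hγ0]
    -- the integral identity
    set c : ℝ := |(γ ^ Module.finrank ℝ (EuclideanSpace ℝ (Fin 3)))⁻¹| with hcdef
    have hc : 0 < c := by
      rw [hcdef, abs_pos]
      exact inv_ne_zero (pow_ne_zero _ hγ0)
    have hident : ∀ s, ∫ y, ⟪w s y, φ y⟫ =
        α * (c * ∫ x, ⟪u (T₁ + β * s) x, ψ x⟫) := by
      intro s
      have h1 : (fun y => ⟪w s y, φ y⟫) =
          fun y => α * (fun x => ⟪u (T₁ + β * s) x, ψ x⟫) (γ • y) := by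
        funext y
        simp only [hwapp, real_inner_smul_left, hψγ]
      rw [h1, integral_const_mul, Measure.integral_comp_smul volume
        (fun x => ⟪u (T₁ + β * s) x, ψ x⟫) γ, smul_eq_mul]
    -- the limit
    have hlim := hfinal ψ hψ
    rw [Metric.tendsto_nhdsWithin_nhds] at hlim
    have hε' : 0 < ε / (α * c) := div_pos hε (mul_pos hα hc)
    obtain ⟨δ, hδ, hδε⟩ := hlim (ε / (α * c)) hε'
    refine ⟨-(δ / β), by rw [neg_lt_zero]; exact div_pos hδ hβ, ?_⟩
    refine (ae_restrict_iff' measurableSet_Ioo).2 (ae_of_all _ fun s hs => ?_)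
    have hs1 : T₁ + β * s ∈ Iio T₁ := by
      show T₁ + β * s < T₁
      nlinarith [hs.2]
    have hs2 : dist (T₁ + β * s) T₁ < δ := by
      rw [Real.dist_eq, add_sub_cancel_left, abs_mul, abs_of_pos hβ, abs_of_neg hs.2]
      have h : -s < δ / β := by linarith [hs.1]
      have h' : -s * β < δ := (lt_div_iff₀ hβ).1 h
      linarith [mul_comm (-s) β]
    have h3 := hδε hs1 hs2
    rw [Real.dist_eq, sub_zero] at h3
    rw [hident, abs_mul, abs_mul, abs_of_pos hα, abs_of_pos hc]
    have h4 : α * (c * |∫ x, ⟪u (T₁ + β * s) x, ψ x⟫|) ≤ α * (c * (ε / (α * c))) := by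
      gcongr
    refine h4.trans (le_of_eq ?_)
    field_simp
  -- ### (iv) regularity of the rescaled field
  have hU4' : ∀ s ∈ Ioo (-1 : ℝ) 0, ContDiffOn ℝ 4 (U' s) S' := by
    intro s hs
    have ht : T₁ + β * s ∈ Ioo T₄ T₁ := by
      refine ⟨?_, by nlinarith [hs.2, hβ]⟩
      rw [hβdef]
      nlinarith [hs.1, hβ, hβdef]
    rw [hU'fun]
    exact ((hUS _ ht).comp e.contDiff.contDiffOn (fun y hy => hmapsγ hy)).const_smul α
  have hΦ' : ∀ n ≤ 4, ContinuousOn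
      (fun z : ℝ × EuclideanSpace ℝ (Fin 3) => iteratedFDeriv ℝ n (U' z.1) z.2) Ω' := by
    intro n hn
    have hg : ContinuousOn (fun z : ℝ × EuclideanSpace ℝ (Fin 3) =>
        α • (iteratedFDeriv ℝ n (U (T₁ + β * z.1)) (γ • z.2)).compContinuousLinearMap
          fun _ => (e : EuclideanSpace ℝ (Fin 3) →L[ℝ] EuclideanSpace ℝ (Fin 3))) Ω' := by
      have h1 : ContinuousOn (fun z : ℝ × EuclideanSpace ℝ (Fin 3) =>
          iteratedFDeriv ℝ n (U (T₁ + β * z.1)) (γ • z.2)) Ω' :=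
        (hjc n hn).comp hΦc.continuousOn hmaps
      exact ((ContinuousMultilinearMap.continuous_precomp
        (fun _ : Fin n => (e : EuclideanSpace ℝ (Fin 3) →L[ℝ] EuclideanSpace ℝ (Fin 3)))
          ).comp_continuousOn h1).const_smul α
    exact hg.congr fun z hz => hformula n z hz
  -- the uniform bound `K' = α K₀ G³`, `G = max 1 γ`
  set G : ℝ := max 1 γ with hGdef
  have hG1 : 1 ≤ G := le_max_left _ _
  have hγG : γ ≤ G := le_max_right _ _
  set K' : ℝ := α * K₀ * G ^ 3 with hK'def
  have hK'bd : ∀ n ≤ 3, ∀ z ∈ Ω', ‖iteratedFDeriv ℝ n (U' z.1) z.2‖ ≤ K' := by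
    intro n hn z hz
    rw [hformula n z hz, norm_smul, Real.norm_of_nonneg hα.le]
    have h1 : ‖(iteratedFDeriv ℝ n (U (T₁ + β * z.1)) (γ • z.2)).compContinuousLinearMap
        fun _ => (e : EuclideanSpace ℝ (Fin 3) →L[ℝ] EuclideanSpace ℝ (Fin 3))‖ ≤ K₀ * G ^ 3 := by
      refine (ContinuousMultilinearMap.norm_compContinuousLinearMap_le _ _).trans ?_
      rw [Finset.prod_const, Finset.card_univ, Fintype.card_fin]
      have h2 : ‖iteratedFDeriv ℝ n (U (T₁ + β * z.1)) (γ • z.2)‖ ≤ K₀ :=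
        hbdK' n hn (T₁ + β * z.1, γ • z.2) ⟨hmaps1 z hz, hmaps2 z hz⟩
      have h3 : ‖(e : EuclideanSpace ℝ (Fin 3) →L[ℝ] EuclideanSpace ℝ (Fin 3))‖ ^ n ≤ G ^ 3 :=
        calc ‖(e : EuclideanSpace ℝ (Fin 3) →L[ℝ] EuclideanSpace ℝ (Fin 3))‖ ^ n ≤ G ^ n :=
              pow_le_pow_left₀ (norm_nonneg _) (henorm.trans hγG) n
          _ ≤ G ^ 3 := pow_le_pow_right₀ hG1 hn
      exact mul_le_mul h2 h3 (pow_nonneg (norm_nonneg _) _) hK₀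
    calc α * ‖(iteratedFDeriv ℝ n (U (T₁ + β * z.1)) (γ • z.2)).compContinuousLinearMap
          fun _ => (e : EuclideanSpace ℝ (Fin 3) →L[ℝ] EuclideanSpace ℝ (Fin 3))‖
        ≤ α * (K₀ * G ^ 3) := mul_le_mul_of_nonneg_left h1 hα.le
      _ = K' := by rw [hK'def]; ring
  -- ### (v) backward uniqueness in the class `C¹ ∩ {∂ₓω ∈ C¹}`: `curl U' = 0` beyond `R' + 1`
  have hzero : ∀ z ∈ Ioo (-1 : ℝ) 0 ×ˢ {y : EuclideanSpace ℝ (Fin 3) | R' + 1 < ‖y‖},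
      curl (U' z.1) z.2 = 0 :=
    farField_curl_eq_zero hR' htop hae' hsol' hU4' hΦ' hK'bd
  -- ### (vi) back to `U`: `curl U(t, ·) = 0` on `{|x| > R + γ}`
  intro t ht x hxn
  have hxS : x ∈ S := by
    show x ∉ closedBall (0 : EuclideanSpace ℝ (Fin 3)) R
    rw [mem_closedBall, dist_zero_right, not_le]
    linarith [hγ.le]
  -- the rescaled point `(s, y)`
  set s : ℝ := (t - T₁) / β with hsdef
  have hts : T₁ + β * s = t := by rw [hsdef]; field_simp; ring
  have hs : s ∈ Ioo (-1 : ℝ) 0 := by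
    rw [hsdef]
    constructor
    · rw [lt_div_iff₀ hβ]; rw [hβdef]; linarith [ht.1]
    · rw [div_lt_iff₀ hβ]; linarith [ht.2]
  set y : EuclideanSpace ℝ (Fin 3) := γ⁻¹ • x with hydef
  have hyx : γ • y = x := by rw [hydef, smul_inv_smul₀ hγ0]
  have hy : R' + 1 < ‖y‖ := by
    rw [hydef, norm_smul, norm_inv, Real.norm_of_nonneg hγ.le, hR'def, ← div_eq_inv_mul,
      lt_div_iff₀ hγ]
    nlinarith [hxn, div_mul_cancel₀ R hγ0]
  have h0 := hzero (s, y) ⟨hs, hy⟩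
  simp only at h0
  -- `curl U'(s, ·)(y) = αγ • curl U(t, ·)(x)`
  have hdU : DifferentiableAt ℝ (U t) x :=
    ((hCD (t, x) ⟨ht, hxS⟩).differentiableAt (by simp)).differentiableWithinAt.differentiableAt
      (hSo.mem_nhds hxS)
  have hderiv : HasFDerivAt (U' s)
      (α • (fderiv ℝ (U t) x).comp
        (γ • ContinuousLinearMap.id ℝ (EuclideanSpace ℝ (Fin 3)))) y := by
    rw [hU'fun, hts]
    have h1 : HasFDerivAt (fun y : EuclideanSpace ℝ (Fin 3) => γ • y)
        (γ • ContinuousLinearMap.id ℝ (EuclideanSpace ℝ (Fin 3))) y :=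
      (hasFDerivAt_id y).const_smul γ
    have h2 : HasFDerivAt (U t) (fderiv ℝ (U t) x) (γ • y) := by
      rw [hyx]; exact hdU.hasFDerivAt
    exact (h2.comp y h1).const_smul α
  have hcomp : (fderiv ℝ (U t) x).comp (γ • ContinuousLinearMap.id ℝ (EuclideanSpace ℝ (Fin 3)))
      = γ • fderiv ℝ (U t) x := by
    ext1 v
    simp
  have hcurl : curl (U' s) y = (α * γ) • curl (U t) x := by
    rw [curl_eq_curlCLM, curl_eq_curlCLM, hderiv.fderiv, hcomp, smul_smul, map_smul]
  rw [hcurl] at h0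
  exact (smul_eq_zero.1 h0).resolve_left hαγ0


/-! ### From `U t → 0` in `𝓢'` to the weak vanishing of the slices against real test fields -/

/-- **"`NS(u₀)(t) → 0` in `𝓢'`" gives `∫ ⟪u(t), φ⟫ → 0` for real vector test fields.** If the
tempered distributions `U i ∈ 𝓢'(ℝ³, ℂ³)` tend to `0` along a filter and `U i` is (eventually)
the distribution of the field `u i` (`IsDistributionOf`), then `∫ ⟪u i x, φ x⟫ dx → 0` for every
smooth compactly supported `φ : ℝ³ → ℝ³`: coordinatewise, `⟨U i, φⱼ⟩ = complexify (∫ φⱼ • u i)`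
for the real test functions `φⱼ = (φ ·)ⱼ` viewed as complex Schwartz functions, the
complexification is an isometry, and `∫ ⟪u i, φ⟫ = Σⱼ (∫ φⱼ • u i)ⱼ`. This is the form in which
the hypothesis of GKP 2016, Prop. 2.3 ("`NS(u₀)(t) → 0` in `𝓢'` as `t ↗ T*`") enters the
backward-uniqueness step (§2.5, p. 9). [cite: GKP2016, §2.5 (proof of Prop. 2.3)] -/
theorem tendsto_integral_inner_of_tendsto_temperedDistribution_zero {α : Type*} {l : Filter α}
    {u : α → EuclideanSpace ℝ (Fin 3) → EuclideanSpace ℝ (Fin 3)}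
    {U : α → 𝓢'(EuclideanSpace ℝ (Fin 3), EuclideanSpace ℂ (Fin 3))}
    (hU : ∀ᶠ i in l, IsDistributionOf (u i) (U i)) (hlim : Tendsto U l (𝓝 0))
    {φ : EuclideanSpace ℝ (Fin 3) → EuclideanSpace ℝ (Fin 3)} (hφ : ContDiff ℝ (⊤ : ℕ∞) φ)
    (hφc : HasCompactSupport φ) :
    Tendsto (fun i => ∫ x, ⟪u i x, φ x⟫) l (𝓝 0) := by
  -- the real coordinate test functions `g j = (φ ·) j`
  set g : Fin 3 → EuclideanSpace ℝ (Fin 3) → ℝ := fun j x => φ x j with hgdef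
  have hg : ∀ j, ContDiff ℝ ((⊤ : ℕ∞) : WithTop ℕ∞) (g j) := fun j =>
    (EuclideanSpace.proj (𝕜 := ℝ) j).contDiff.comp hφ
  have hgs : ∀ j, HasCompactSupport (g j) := fun j =>
    hφc.comp_left (g := fun v : EuclideanSpace ℝ (Fin 3) => v j) rfl
  -- each `∫ g j • u i → 0`
  have hcoord : ∀ j, Tendsto (fun i => ∫ x, g j x • u i x) l (𝓝 0) := by
    intro j
    have hcs : HasCompactSupport fun y => ((g j y : ℝ) : ℂ) := (hgs j).comp_left Complex.ofReal_zero
    have hcd : ContDiff ℝ ((⊤ : ℕ∞) : WithTop ℕ∞) fun y => ((g j y : ℝ) : ℂ) :=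
      Complex.ofRealCLM.contDiff.comp (hg j)
    set θ : 𝓢(EuclideanSpace ℝ (Fin 3), ℂ) := hcs.toSchwartzMap hcd with hθ
    have hθ_apply : ∀ y, θ y = ((g j y : ℝ) : ℂ) := fun y => rfl
    have hrepr : ∀ᶠ i in l,
        U i θ = FunctionSpaces.EuclideanSpace.complexify (∫ y, g j y • u i y) := by
      filter_upwards [hU] with i hi
      rw [(hi θ).2]
      have e : (fun y => θ y • FunctionSpaces.EuclideanSpace.complexify (u i y)) =
          fun y => FunctionSpaces.EuclideanSpace.complexify (g j y • u i y) := by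
        funext y
        rw [hθ_apply, map_smul, Complex.coe_smul]
      rw [e]
      exact (FunctionSpaces.EuclideanSpace.complexify (ι := Fin 3)).toContinuousLinearMap
        |>.integral_comp_comm
          (hi.locallyIntegrable.integrable_smul_left_of_hasCompactSupport (hg j).continuous (hgs j))
    have h0 : Tendsto (fun i => U i θ) l (𝓝 0) := by
      have h := (PointwiseConvergenceCLM.tendsto_iff_forall_tendsto.1 hlim) θ
      simpa using h
    have h1 : Tendsto (fun i => FunctionSpaces.EuclideanSpace.complexify (∫ y, g j y • u i y)) l
        (𝓝 0) :=
      h0.congr' hrepr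
    rw [tendsto_zero_iff_norm_tendsto_zero] at h1 ⊢
    refine h1.congr fun i => ?_
    exact FunctionSpaces.EuclideanSpace.norm_complexify _
  -- the pairing as a sum of coordinates of the vector integrals
  have hsum : ∀ᶠ i in l, ∫ x, ⟪u i x, φ x⟫ = ∑ j, (∫ x, g j x • u i x) j := by
    filter_upwards [hU] with i hi
    have hint : ∀ j, Integrable (fun x => g j x • u i x) volume := fun j =>
      hi.locallyIntegrable.integrable_smul_left_of_hasCompactSupport (hg j).continuous (hgs j)
    have hproj : ∀ j, (∫ x, g j x • u i x) j = ∫ x, (g j x • u i x) j := fun j =>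
      ((EuclideanSpace.proj (𝕜 := ℝ) j).integral_comp_comm (hint j)).symm
    have hintj : ∀ j, Integrable (fun x => (g j x • u i x) j) volume := fun j =>
      (EuclideanSpace.proj (𝕜 := ℝ) j).integrable_comp (hint j)
    simp_rw [hproj]
    rw [← integral_finsetSum _ fun j _ => hintj j]
    refine integral_congr_ae (ae_of_all _ fun x => ?_)
    simp only [PiLp.inner_apply, PiLp.smul_apply, smul_eq_mul, hgdef, RCLike.inner_apply,
      conj_trivial]
  have hlim' : Tendsto (fun i => ∑ j, (∫ x, g j x • u i x) j) l (𝓝 0) := by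
    have h : Tendsto (fun i => ∑ j, (∫ x, g j x • u i x) j) l (𝓝 (∑ j : Fin 3, (0 : ℝ))) := by
      refine tendsto_finsetSum _ fun j _ => ?_
      have h2 := ((EuclideanSpace.proj (𝕜 := ℝ) j).continuous.tendsto 0).comp (hcoord j)
      simp only [map_zero] at h2
      exact h2
    simpa using h
  exact hlim'.congr' (hsum.mono fun i hi => hi.symm)


/-! ### Step D of GKP §2.5 for a classical solution: far field and interior -/

/-- **Step D of the proof of GKP 2016, Prop. 2.3, for a classical solution: the vorticity
vanishes identically near the final time.** Let `(u, π)` be a classical solution of the unforced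
Navier–Stokes equations (`ν > 0`) on the open strip `(0, T)` — for `u = NS(u₀)` this is (1.6),
"`u ∈ C^∞(ℝ³ × (0, T*))`" — whose spatial derivatives of order `≤ 3` are bounded on a far-field
region `(T₄, T) × {|x| > R}`, `0 < T₄ < T`, `R ≥ 0` ("smooth at and near the time `T*` outside
of some large compact set `K`", the output of Prop. 2.8 and ε-regularity), and whose slices
tend to zero weakly as `t ↑ T` (`∫ ⟪u(t), φ⟫ → 0` for all smooth compactly supported `φ`; from
"`u(t) → 0` in `𝓢'`" by `tendsto_integral_inner_of_tendsto_temperedDistribution_zero`). Then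
`∇ ∧ u(t, ·) ≡ 0` on `ℝ³` for every `t ∈ (T₄, T)`: in the far field `{|x| > R + √(ν(T - T₄))}`
by backward uniqueness (`farField_curl_eq_zero_of_frame`, the classical solution being a
distributional solution on the far-field region with jointly continuous bounded derivatives),
and then everywhere by the unique continuation of the vorticity of a classical solution through
spatial boundaries (`IsClassicalNSSolutionOn.curl_eq_zero_of_eqOn_ball`, ESS Thm. 4.1: "in
applying the latter we need the smoothness inside `K` at earlier times provided by (1.6)").
[cite: GKP2016, §2.5 (proof of Prop. 2.3)] [cite: EscauriazaSereginSverak2003, Thm. 4.1, Thm. 5.1 and §5] -/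
theorem IsClassicalNSSolutionOn.curl_eq_zero_of_farField_of_tendsto {ν T T₄ R K : ℝ}
    (hν : 0 < ν) {u : ℝ → EuclideanSpace ℝ (Fin 3) → EuclideanSpace ℝ (Fin 3)}
    {π : ℝ → EuclideanSpace ℝ (Fin 3) → ℝ} (hcl : IsClassicalNSSolutionOn (Ioo 0 T) ν 0 u π)
    (hT₄ : 0 < T₄) (hT₄T : T₄ < T) (hR : 0 ≤ R)
    (hbd : ∀ n ≤ 3, ∀ w ∈ Ioo T₄ T ×ˢ (closedBall (0 : EuclideanSpace ℝ (Fin 3)) R)ᶜ,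
      ‖iteratedFDeriv ℝ n (u w.1) w.2‖ ≤ K)
    (hfinal : ∀ φ : EuclideanSpace ℝ (Fin 3) → EuclideanSpace ℝ (Fin 3),
      FunctionSpaces.IsTestFunctionOn (⊤ : Opens (EuclideanSpace ℝ (Fin 3))) φ →
        Tendsto (fun t => ∫ x, ⟪u t x, φ x⟫) (𝓝[<] T) (𝓝 0)) :
    ∀ t ∈ Ioo T₄ T, ∀ x : EuclideanSpace ℝ (Fin 3), curl (u t) x = 0 := by
  set S : Set (EuclideanSpace ℝ (Fin 3)) := (closedBall (0 : EuclideanSpace ℝ (Fin 3)) R)ᶜ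
    with hSdef
  have hSo : IsOpen S := isClosed_closedBall.isOpen_compl
  set Ω : Set (ℝ × EuclideanSpace ℝ (Fin 3)) := Ioo T₄ T ×ˢ S with hΩdef
  have hΩo : IsOpen Ω := isOpen_Ioo.prod hSo
  have hsub : Ioo T₄ T ⊆ Ioo 0 T := Ioo_subset_Ioo hT₄.le le_rfl
  have hΩsub : Ω ⊆ Ioo 0 T ×ˢ univ := prod_mono hsub (subset_univ _)
  -- ## the classical solution is a distributional solution on the far-field region
  have hsol : IsDistributionalNSSolutionOn ⟨Ω, hΩo⟩ ν 0 u π := by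
    have hw2 : ContDiffOn ℝ 2 (uncurry u) (Ioo 0 T ×ˢ univ) :=
      hcl.smooth_velocity.of_le (by norm_cast)
    have hp1 : ContDiffOn ℝ 1 (uncurry π) (Ioo 0 T ×ˢ univ) :=
      hcl.smooth_pressure.of_le (by norm_cast)
    have hf : ContinuousOn
        (uncurry (0 : ℝ → EuclideanSpace ℝ (Fin 3) → EuclideanSpace ℝ (Fin 3)))
        (Ioo 0 T ×ˢ univ) := continuousOn_const
    refine isDistributionalNSSolutionOn_of_contDiffOn isOpen_Ioo hΩsub hw2 hp1 hf
      (fun t ht x => ?_) hcl.divFree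
    have hm := hcl.momentum t ht x
    rwa [timeDerivWithin_eq_deriv isOpen_Ioo ht, ← timeDeriv_apply] at hm
  -- ## joint regularity of the slices
  have hCD : ∀ w ∈ Ω, ContDiffAt ℝ (⊤ : ℕ∞) (u w.1) w.2 := fun w hw =>
    (hcl.contDiff_velocity (hsub hw.1)).contDiffAt
  have hjc : ∀ n ≤ 4, ContinuousOn
      (fun w : ℝ × EuclideanSpace ℝ (Fin 3) => iteratedFDeriv ℝ n (u w.1) w.2) Ω := by
    intro n _
    have h := (hcl.smooth_velocity.iteratedFDeriv_slice (uniqueDiffOn_Ioo 0 T) n).continuousOn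
    exact h.mono hΩsub
  -- ## the far field: backward uniqueness
  have hfar := farField_curl_eq_zero_of_frame hν hT₄T hR hfinal (EventuallyEq.refl _ _) hsol hCD
    hjc hbd
  -- ## the interior: unique continuation from a ball in the far field
  set γ : ℝ := Real.sqrt (ν * (T - T₄)) with hγdef
  have hγ : 0 ≤ γ := Real.sqrt_nonneg _
  set xc : EuclideanSpace ℝ (Fin 3) := (R + γ + 2) • EuclideanSpace.basisFun (Fin 3) ℝ 0
    with hxcdef
  have hxc : ‖xc‖ = R + γ + 2 := by
    rw [hxcdef, norm_smul, Real.norm_eq_abs, (EuclideanSpace.basisFun (Fin 3) ℝ).orthonormal.1 0,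
      mul_one, abs_of_nonneg (by linarith)]
  have hball : ∀ x ∈ ball xc 1, R + γ < ‖x‖ := by
    intro x hx
    rw [mem_ball, dist_eq_norm] at hx
    have h1 : ‖xc‖ ≤ ‖x‖ + ‖x - xc‖ :=
      calc ‖xc‖ = ‖x - (x - xc)‖ := by rw [sub_sub_cancel]
        _ ≤ ‖x‖ + ‖x - xc‖ := norm_sub_le _ _
    linarith
  have hzero : ∀ t ∈ Ioo T₄ T, ∀ x ∈ ball xc 1, curl (u t) x = 0 := fun t ht x hx =>
    hfar t ht x (hball x hx)
  exact hcl.curl_eq_zero_of_eqOn_ball hν hT₄ le_rfl one_pos hzero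

/-! ### Steps D–E: the solution vanishes near the final time -/

/-- **Steps D–E of the proof of GKP 2016, Prop. 2.3, for a classical solution: `u(·, t) ≡ 0`
near the final time.** In the situation of
`IsClassicalNSSolutionOn.curl_eq_zero_of_farField_of_tendsto` suppose moreover that the slices
`u t`, `t ∈ (T₄, T)`, are bounded and are realised homogeneous Besov distributions: `V t` is
the tempered distribution of `u t` and `V t ∈ Ḃ^s_{p,q}` (for `NS(u₀)`: Kato's class and
`NS(u₀) ∈ C([0,T]; Ḃ^{s_p}_{p,p})`, (1.6)). Then `u(t, ·) ≡ 0` for every `t ∈ (T₄, T)`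
("allow us to conclude that in fact `u(·, t) ≡ 0` for some `t ∈ (0, T*)`"): the slice is
smooth, bounded, divergence free and irrotational (Step D), hence constant by the Liouville
theorem for `curl V = 0`, `div V = 0` (KNSS 2009, Lemma 3.1), and realised Besov distributions
contain no non-zero constants (Step E, `eq_zero_of_curl_eq_zero_of_isDivFree_of_memHomBesov`).
[cite: GKP2016, §2.5 (proof of Prop. 2.3)] [cite: KochNadirashviliSereginSverak2009, Lemma 3.1] -/
theorem IsClassicalNSSolutionOn.eq_zero_of_farField_of_tendsto {ν T T₄ R K : ℝ}
    (hν : 0 < ν) {u : ℝ → EuclideanSpace ℝ (Fin 3) → EuclideanSpace ℝ (Fin 3)}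
    {π : ℝ → EuclideanSpace ℝ (Fin 3) → ℝ} (hcl : IsClassicalNSSolutionOn (Ioo 0 T) ν 0 u π)
    (hT₄ : 0 < T₄) (hT₄T : T₄ < T) (hR : 0 ≤ R)
    (hbd : ∀ n ≤ 3, ∀ w ∈ Ioo T₄ T ×ˢ (closedBall (0 : EuclideanSpace ℝ (Fin 3)) R)ᶜ,
      ‖iteratedFDeriv ℝ n (u w.1) w.2‖ ≤ K)
    (hfinal : ∀ φ : EuclideanSpace ℝ (Fin 3) → EuclideanSpace ℝ (Fin 3),
      FunctionSpaces.IsTestFunctionOn (⊤ : Opens (EuclideanSpace ℝ (Fin 3))) φ →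
        Tendsto (fun t => ∫ x, ⟪u t x, φ x⟫) (𝓝[<] T) (𝓝 0))
    (hM : ∀ t ∈ Ioo T₄ T, ∃ M : ℝ, ∀ x, ‖u t x‖ ≤ M)
    {s : ℝ} {p q : ℝ≥0∞} [Fact (1 ≤ p)]
    {V : ℝ → 𝓢'(EuclideanSpace ℝ (Fin 3), EuclideanSpace ℂ (Fin 3))}
    (hV : ∀ t ∈ Ioo T₄ T, IsDistributionOf (u t) (V t))
    (hB : ∀ t ∈ Ioo T₄ T, FunctionSpaces.MemHomBesov s p q (V t)) :
    ∀ t ∈ Ioo T₄ T, u t = 0 := by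
  have hcurl := hcl.curl_eq_zero_of_farField_of_tendsto hν hT₄ hT₄T hR hbd hfinal
  intro t ht
  have ht0 : t ∈ Ioo 0 T := ⟨hT₄.trans ht.1, ht.2⟩
  obtain ⟨M, hMt⟩ := hM t ht
  exact eq_zero_of_curl_eq_zero_of_isDivFree_of_memHomBesov
    ((hcl.contDiff_velocity ht0).of_le (by norm_cast)) (hcurl t ht) (hcl.divFree t ht0) hMt
    (hV t ht) (hB t ht)

/-! ### The packaging for a Besov mild solution which is classical for positive times -/

/-- The slices of a Besov mild solution at positive times are essentially bounded (Kato's class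
`K_∞`: `sup_{0<τ<t'} √τ ‖u(τ)‖_∞ < ∞` for `t' < T`). [cite: GKP2016, (1.6)] -/
theorem IsBesovMildSolutionOn.eLpNorm_top_lt_top {ι : Type*} [Fintype ι] {s : ℝ} {p q : ℝ≥0∞}
    [Fact (1 ≤ p)] {T ν : ℝ} {u : ℝ → EuclideanSpace ℝ ι → EuclideanSpace ℝ ι}
    {U : ℝ → 𝓢'(EuclideanSpace ℝ ι, EuclideanSpace ℂ ι)} (hu : IsBesovMildSolutionOn s p q T ν u U)
    {t : ℝ} (ht : t ∈ Ioo 0 T) : eLpNorm (u t) ∞ volume < ∞ := by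
  obtain ⟨t', htt', ht'T⟩ := exists_between ht.2
  have hsup := hu.memKatoClassOn.1 t' ht'T
  have hle : ENNReal.ofReal (Real.sqrt t) * eLpNorm (u t) ∞ volume ≤
      ⨆ τ ∈ Ioo 0 t', ENNReal.ofReal (Real.sqrt τ) * eLpNorm (u τ) ∞ volume :=
    le_biSup (fun τ => ENNReal.ofReal (Real.sqrt τ) * eLpNorm (u τ) ∞ volume) ⟨ht.1, htt'⟩
  have hfin : ENNReal.ofReal (Real.sqrt t) * eLpNorm (u t) ∞ volume < ∞ := hle.trans_lt hsup
  have hpos : ENNReal.ofReal (Real.sqrt t) ≠ 0 := by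
    rw [Ne, ENNReal.ofReal_eq_zero, not_le]
    exact Real.sqrt_pos.2 ht.1
  exact (ENNReal.mul_lt_top_iff.1 hfin).elim (fun h => h.2)
    (fun h => h.elim (fun h0 => absurd h0 hpos) (fun h0 => by rw [h0]; exact WithTop.top_pos))

/-- **GKP 2016, Prop. 2.3, Steps C–E of its proof, for a Besov mild solution which is classical
for positive times.** Let `(u, U)` be a Besov mild solution of the class `(s, p, q)` on `[0, T)`
(the tree's `IsBesovMildSolutionOn`: duality-form mild, `U t` the distribution of `u t`,
`U ∈ C([0,T); Ḃ^s_{p,q})`, Kato's class `K_∞`) which is a classical solution with some pressure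
`π` on the open strip `(0, T)` — for `u = NS(u₀)` this is (1.6), "`u ∈ C^∞(ℝ³ × (0, T*))`" —
and assume, as in Prop. 2.3, that `U t → 0` in `𝓢'(ℝ³, ℂ³)` as `t → T⁻`, and, as produced in
§2.5 from Prop. 2.8 and ε-regularity, that the spatial derivatives of `u` of order `≤ 3` are
bounded on a far-field region `(T₄, T) × {|x| > R}`, `0 < T₄ < T`. Then `u(t, ·) ≡ 0` for every
`t ∈ (T₄, T)` ("… allow us to conclude that in fact `u(·, t) ≡ 0` for some `t ∈ (0, T*)`";
the remaining sentence "therefore `T* = ∞` by small data results" is the endgame of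
`GKPRigidityProofs.lean`). Proof: `IsClassicalNSSolutionOn.eq_zero_of_farField_of_tendsto`,
the weak vanishing of the slices coming from `U t → 0`
(`tendsto_integral_inner_of_tendsto_temperedDistribution_zero`), their bounds from Kato's
class and the continuity of the classical slices, and `U t ∈ Ḃ^s_{p,q}` from
`ContinuousInHomBesovOn`. [cite: GKP2016, Prop. 2.3 and §2.5] -/
theorem IsBesovMildSolutionOn.eq_zero_of_classical_of_farField_of_tendsto {s : ℝ} {p q : ℝ≥0∞}
    [Fact (1 ≤ p)] {ν T T₄ R K : ℝ} (hν : 0 < ν)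
    {u : ℝ → EuclideanSpace ℝ (Fin 3) → EuclideanSpace ℝ (Fin 3)}
    {U : ℝ → 𝓢'(EuclideanSpace ℝ (Fin 3), EuclideanSpace ℂ (Fin 3))}
    {π : ℝ → EuclideanSpace ℝ (Fin 3) → ℝ} (hu : IsBesovMildSolutionOn s p q T ν u U)
    (hcl : IsClassicalNSSolutionOn (Ioo 0 T) ν 0 u π) (hT₄ : 0 < T₄) (hT₄T : T₄ < T) (hR : 0 ≤ R)
    (hbd : ∀ n ≤ 3, ∀ w ∈ Ioo T₄ T ×ˢ (closedBall (0 : EuclideanSpace ℝ (Fin 3)) R)ᶜ,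
      ‖iteratedFDeriv ℝ n (u w.1) w.2‖ ≤ K)
    (hlim : Tendsto U (𝓝[<] T) (𝓝 0)) :
    ∀ t ∈ Ioo T₄ T, u t = 0 := by
  have hT : 0 < T := hT₄.trans hT₄T
  have hev : ∀ᶠ t in 𝓝[<] T, IsDistributionOf (u t) (U t) := by
    filter_upwards [Ico_mem_nhdsLT hT] with t ht using hu.isDistributionOf t ht
  have hfinal : ∀ φ : EuclideanSpace ℝ (Fin 3) → EuclideanSpace ℝ (Fin 3),
      FunctionSpaces.IsTestFunctionOn (⊤ : Opens (EuclideanSpace ℝ (Fin 3))) φ →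
        Tendsto (fun t => ∫ x, ⟪u t x, φ x⟫) (𝓝[<] T) (𝓝 0) := fun φ hφ =>
    tendsto_integral_inner_of_tendsto_temperedDistribution_zero hev hlim hφ.contDiff
      hφ.hasCompactSupport
  have hM : ∀ t ∈ Ioo T₄ T, ∃ M : ℝ, ∀ x, ‖u t x‖ ≤ M := by
    intro t ht
    have ht0 : t ∈ Ioo 0 T := ⟨hT₄.trans ht.1, ht.2⟩
    have hfin := hu.eLpNorm_top_lt_top ht0
    exact ⟨(eLpNorm (u t) ∞ volume).toReal, norm_le_of_eLpNorm_top_le_of_continuous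
      (hcl.contDiff_velocity ht0).continuous hfin.ne le_rfl⟩
  refine hcl.eq_zero_of_farField_of_tendsto hν hT₄ hT₄T hR hbd hfinal hM
    (V := U) (s := s) (p := p) (q := q) (fun t ht => hu.isDistributionOf t ?_) (fun t ht => ?_)
  · exact ⟨(hT₄.trans ht.1).le, ht.2⟩
  · exact hu.continuousInHomBesovOn.1 t ⟨(hT₄.trans ht.1).le, ht.2⟩

end Literature.Analysis.FluidPDE

end
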